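import Summits.ABC.ABC.Theorems.IneffectiveSubspaceDepthCountedABCStubCalibration

/-!
# Stub `stub_cellTwoOfPolyPillai` of line `Sketch` — crux `IneffectiveSubspace.DepthCountedABC` (stmt-ABC-14938)

THE POLYNOMIAL FACE OF CELL 2 (lead c19).  On the cells `ω₅ ≤ 1` abc holds for free at exponent 4
(`stub_calibration`); on the cell `ω₅(abc) ≤ 2` NO polynomial exponent is in print.  This certificate locates the
obstruction: EVERY placement of the two deep primes is elementary (`c ≤ rad⁸`) except deep `r ∣ b`, `s ∣ c` with
`a² < c`, where the triple reads `a + r^v·u = s^w·v'` with `a, u, v'` 5-free — a GENERALIZED PILLAI configuration —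
and a polynomial generalized Pillai bound `s^w·v' ≤ C·(r·s·a·u·v')^N` (open for every `N`; linear forms in logarithms
give it only quasi-polynomially, `exp(O(log³rad·log log rad))`, and are exhausted at `r, s ≈ e^√(log c)`) yields abc
on the cell `ω₅ ≤ 2` with the polynomial exponent `14N + 8`.  (The converse — a polynomial exponent on the cell gives
polynomial generalized Pillai on the configurations lying in the cell — is immediate from `rad ≤ r·s·a·u·v'`.)

Proof: for a triple of the cell ordered `a ≤ b` let `D` be its set of deep primes (`#D ≤ 2`).  A member met by no
deep prime is 5-free, hence `≤ rad⁴` (`stub_calibration` lemmas).  If no deep prime meets `c`, `c ≤ rad⁴`; else if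
none meets `b`, `c ≤ 2b ≤ 2rad⁴`; else deep `r ∣ b`, `s ∣ c`, `r ≠ s`, `D = {r, s}`, so `a` is 5-free (`a ≤ rad⁴`) and
either `c ≤ a² ≤ rad⁸` or the Pillai bound applies to `u = b/r^{v_r(b)}`, `v' = c/s^{v_s(c)}` (both met by no deep
prime, so `≤ rad⁴`) with `r, s ≤ rad`: `c ≤ C·rad^(14N)`.

Sources: skeleton `Cruxes/DepthCountedABC/Lines/Sketch.lean` (lead c19, stub `stub_cellTwoOfPolyPillai`); lemmas of
`IneffectiveSubspaceDepthCountedABCStubCalibration`.  Mathlib only otherwise (`Nat.ordProj_mul_ordCompl_eq_self`,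
`Nat.not_dvd_ordCompl`, `Nat.primeFactors_radical`, `Finset.eq_of_subset_of_card_le`).
-/

-- `Summit.<Summit>.<Problem>` is the mandated summit-side namespace (CONVENTIONS §2); for the
-- single-conjunct summit `ABC` the two coincide, so the duplicate `ABC.ABC` is deliberate.
set_option linter.dupNamespace false

namespace Summit.ABC.ABC.Theorems.DepthCountedABC

section CellTwo
open UniqueFactorizationMonoid (radical)
open Literature.NumberTheory.DiophantineGeometry (IsABCTriple rad rad_def)

/-- The case analysis of the cell `ω₅ ≤ 2` for a triple ordered `a ≤ b`: either `c ≤ 2·rad(abc)⁸`, or the triple is a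
generalized Pillai configuration `a + r^v·u = s^w·v'` (`r, s` prime) with `r·s·a·u·v' ≤ rad(abc)¹⁴`. [folklore] -/
theorem cellTwo_cases {a b c : ℕ} (h : IsABCTriple a b c) (hab : a ≤ b)
    (hK : ((a * b * c).primeFactors.filter (fun p => 5 ≤ (a * b * c).factorization p)).card ≤ 2) :
    c ≤ 2 * (rad a b c) ^ 8 ∨
    ∃ r s u v' v w : ℕ, r.Prime ∧ s.Prime ∧ 0 < u ∧ 0 < v' ∧ a + r ^ v * u = s ^ w * v' ∧
      Nat.Coprime (r ^ v * u) (s ^ w * v') ∧ c = s ^ w * v' ∧ r * s * a * u * v' ≤ (rad a b c) ^ 14 := by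
  obtain ⟨ha, hb, hsum, hcop⟩ := h
  have hc : 0 < c := by omega
  have hne : a * b * c ≠ 0 := by positivity
  have hb0 : b ≠ 0 := hb.ne'
  have hc0 : c ≠ 0 := hc.ne'
  have hac : Nat.Coprime a c := by rw [← hsum, Nat.coprime_self_add_right]; exact hcop
  have hbc : Nat.Coprime b c := by rw [← hsum, add_comm, Nat.coprime_self_add_right]; exact hcop.symm
  have hda : a ∣ a * b * c := dvd_mul_of_dvd_left (dvd_mul_right a b) c
  have hdb : b ∣ a * b * c := dvd_mul_of_dvd_left (dvd_mul_left b a) c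
  have hdc : c ∣ a * b * c := dvd_mul_left c (a * b)
  set D := (a * b * c).primeFactors.filter (fun p => 5 ≤ (a * b * c).factorization p) with hD
  set R := rad a b c with hR
  have hRdef : R = radical (a * b * c) := rad_def a b c
  have hR1 : 1 ≤ R := by rw [hRdef]; exact Nat.radical_pos _
  -- a factor of `abc` met by no deep prime is 5-free, hence `≤ R⁴`
  have shallow : ∀ x : ℕ, x ∣ a * b * c → (∀ t ∈ D, ¬ t ∣ x) → x ≤ R ^ 4 := by
    intro x hxd hxD
    rw [hRdef]
    refine calibration_le_radical_pow_four_of_dvd hne hxd (fun t ht => ?_)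
    by_contra hlt
    push Not at hlt
    exact hxD t (calibration_mem_deep_of_factor hne hxd ht hlt) (Nat.dvd_of_mem_primeFactors ht)
  -- members of `D` are primes `≤ R`
  have hDprime : ∀ t ∈ D, t.Prime := fun t ht =>
    Nat.prime_of_mem_primeFactors (Finset.mem_filter.mp ht).1
  have hDleR : ∀ t ∈ D, t ≤ R := by
    intro t ht
    have htf : t ∈ (a * b * c).primeFactors := (Finset.mem_filter.mp ht).1
    rw [hRdef]
    apply Nat.le_of_mem_primeFactors
    rwa [Nat.primeFactors_radical]
  by_cases hcD : ∀ t ∈ D, ¬ t ∣ c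
  · -- no deep prime in `c`
    left
    have h1 : c ≤ R ^ 4 := shallow c hdc hcD
    have h2 : R ^ 4 ≤ R ^ 8 := Nat.pow_le_pow_right hR1 (by norm_num)
    omega
  by_cases hbD : ∀ t ∈ D, ¬ t ∣ b
  · -- no deep prime in `b`
    left
    have h1 : b ≤ R ^ 4 := shallow b hdb hbD
    have h2 : R ^ 4 ≤ R ^ 8 := Nat.pow_le_pow_right hR1 (by norm_num)
    omega
  push Not at hcD hbD
  obtain ⟨s, hsD, hsc⟩ := hcD
  obtain ⟨r, hrD, hrb⟩ := hbD
  have hrp : r.Prime := hDprime r hrD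
  have hsp : s.Prime := hDprime s hsD
  have hrs : r ≠ s := by
    rintro rfl
    exact hrp.one_lt.ne' (Nat.Coprime.eq_one_of_dvd (Nat.Coprime.coprime_dvd_left hrb hbc) hsc)
  -- `D = {r, s}`
  have hDeq : ({r, s} : Finset ℕ) = D := by
    apply Finset.eq_of_subset_of_card_le
    · intro t ht
      rcases Finset.mem_insert.mp ht with rfl | ht'
      · exact hrD
      · rw [Finset.mem_singleton.mp ht']; exact hsD
    · rw [Finset.card_pair hrs]; exact hK
  have hDmem : ∀ t ∈ D, t = r ∨ t = s := by
    intro t ht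
    rw [← hDeq, Finset.mem_insert, Finset.mem_singleton] at ht
    exact ht
  -- `a` meets no deep prime
  have haD : ∀ t ∈ D, ¬ t ∣ a := by
    intro t ht hta
    rcases hDmem t ht with rfl | rfl
    · exact hrp.one_lt.ne' (Nat.Coprime.eq_one_of_dvd (Nat.Coprime.coprime_dvd_left hta hcop) hrb)
    · exact hsp.one_lt.ne' (Nat.Coprime.eq_one_of_dvd (Nat.Coprime.coprime_dvd_left hta hac) hsc)
  have hale : a ≤ R ^ 4 := shallow a hda haD
  by_cases hca : c ≤ a ^ 2
  · left
    calc c ≤ a ^ 2 := hca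
      _ ≤ (R ^ 4) ^ 2 := Nat.pow_le_pow_left hale 2
      _ = R ^ 8 := by ring
      _ ≤ 2 * R ^ 8 := Nat.le_mul_of_pos_left _ (by norm_num)
  -- the generalized Pillai configuration
  right
  set v := b.factorization r with hv
  set u := b / r ^ v with hu
  set w := c.factorization s with hw
  set v' := c / s ^ w with hv'
  have hbu : r ^ v * u = b := Nat.ordProj_mul_ordCompl_eq_self b r
  have hcv : s ^ w * v' = c := Nat.ordProj_mul_ordCompl_eq_self c s
  have hupos : 0 < u := Nat.ordCompl_pos r hb0
  have hv'pos : 0 < v' := Nat.ordCompl_pos s hc0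
  have hud : u ∣ b := Nat.ordCompl_dvd b r
  have hv'd : v' ∣ c := Nat.ordCompl_dvd c s
  -- `u` and `v'` meet no deep prime
  have huD : ∀ t ∈ D, ¬ t ∣ u := by
    intro t ht htu
    rcases hDmem t ht with rfl | rfl
    · exact Nat.not_dvd_ordCompl hrp hb0 htu
    · exact hsp.one_lt.ne' (Nat.Coprime.eq_one_of_dvd (Nat.Coprime.coprime_dvd_left (htu.trans hud) hbc) hsc)
  have hv'D : ∀ t ∈ D, ¬ t ∣ v' := by
    intro t ht htv
    rcases hDmem t ht with rfl | rfl
    · exact hrp.one_lt.ne' (Nat.Coprime.eq_one_of_dvd (Nat.Coprime.coprime_dvd_left hrb hbc) (htv.trans hv'd))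
    · exact Nat.not_dvd_ordCompl hsp hc0 htv
  have hule : u ≤ R ^ 4 := shallow u (hud.trans hdb) huD
  have hv'le : v' ≤ R ^ 4 := shallow v' (hv'd.trans hdc) hv'D
  refine ⟨r, s, u, v', v, w, hrp, hsp, hupos, hv'pos, ?_, ?_, hcv.symm, ?_⟩
  · rw [hbu, hcv, hsum]
  · rw [hbu, hcv]; exact hbc
  · calc r * s * a * u * v' ≤ R * R * R ^ 4 * R ^ 4 * R ^ 4 :=
        Nat.mul_le_mul (Nat.mul_le_mul (Nat.mul_le_mul (Nat.mul_le_mul (hDleR r hrD) (hDleR s hsD)) hale)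
          hule) hv'le
      _ = R ^ 14 := by ring

end CellTwo

open UniqueFactorizationMonoid (radical) in
open Literature.NumberTheory.DiophantineGeometry (IsABCTriple rad rad_def) in
/-- **Stub `stub_cellTwoOfPolyPillai` (the polynomial face of cell 2) of line `Sketch`, crux `DepthCountedABC`
(stmt-ABC-14938):** a polynomial generalized Pillai bound — some `C > 0` with `s^w·v' ≤ C·(r·s·a·u·v')^N` for all
primes `r, s` and positive coprime `a + r^v·u = s^w·v'` — gives abc on the cell `#{p : v_p(abc) ≥ 5} ≤ 2` with the
polynomial exponent `14N + 8`: `c < C'·rad(abc)^(14N+8)`. [folklore reduction; hypothesis open] -/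
theorem stub_cellTwoOfPolyPillai : ∀ N : ℕ,
    (∃ C : ℝ, 0 < C ∧ ∀ r s a u v' v w : ℕ, r.Prime → s.Prime → 0 < a → 0 < u → 0 < v' →
        a + r ^ v * u = s ^ w * v' → Nat.Coprime (r ^ v * u) (s ^ w * v') →
        ((s ^ w * v' : ℕ) : ℝ) ≤ C * ((r * s * a * u * v' : ℕ) : ℝ) ^ N) →
    ∃ C : ℝ, 0 < C ∧ ∀ a b c : ℕ, Literature.NumberTheory.DiophantineGeometry.IsABCTriple a b c →
      ((a * b * c).primeFactors.filter (fun p => 5 ≤ (a * b * c).factorization p)).card ≤ 2 →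
      (c : ℝ) < C * ((Literature.NumberTheory.DiophantineGeometry.rad a b c : ℕ) : ℝ) ^ (14 * N + 8) := by
  intro N hP
  obtain ⟨CP, hCP, hP⟩ := hP
  refine ⟨CP + 3, by positivity, ?_⟩
  intro a b c habc hK
  -- WLOG `a ≤ b`
  wlog hab : a ≤ b generalizing a b with H
  · have hsw : IsABCTriple b a c :=
      ⟨habc.2.1, habc.1, by rw [add_comm]; exact habc.2.2.1, habc.2.2.2.symm⟩
    have hprod : b * a * c = a * b * c := by ring
    have hK' : ((b * a * c).primeFactors.filter (fun p => 5 ≤ (b * a * c).factorization p)).card ≤ 2 := by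
      rw [hprod]; exact hK
    have := H b a hsw hK' (le_of_not_ge hab)
    rwa [rad_def, hprod, ← rad_def] at this
  set R := rad a b c with hR
  have hR1nat : 1 ≤ R := by rw [hR, rad_def]; exact Nat.radical_pos _
  have hx1 : (1 : ℝ) ≤ (R : ℝ) := by exact_mod_cast hR1nat
  have hpow8 : (R : ℝ) ^ 8 ≤ (R : ℝ) ^ (14 * N + 8) := pow_le_pow_right₀ hx1 (by omega)
  have hpow14 : (R : ℝ) ^ (14 * N) ≤ (R : ℝ) ^ (14 * N + 8) := pow_le_pow_right₀ hx1 (by omega)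
  have hRpos : (0 : ℝ) < (R : ℝ) ^ (14 * N + 8) := by positivity
  rcases cellTwo_cases habc hab hK with hle | ⟨r, s, u, v', v, w, hrp, hsp, hu, hv', heq, hcopr, hc, hbd⟩
  · -- elementary placements: `c ≤ 2R⁸`
    have h1 : (c : ℝ) ≤ 2 * (R : ℝ) ^ 8 := by exact_mod_cast hle
    calc (c : ℝ) ≤ 2 * (R : ℝ) ^ 8 := h1
      _ ≤ 2 * (R : ℝ) ^ (14 * N + 8) := by linarith
      _ < (CP + 3) * (R : ℝ) ^ (14 * N + 8) := by nlinarith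
  · -- the Pillai configuration
    have ha : 0 < a := habc.1
    have h1 : ((s ^ w * v' : ℕ) : ℝ) ≤ CP * ((r * s * a * u * v' : ℕ) : ℝ) ^ N :=
      hP r s a u v' v w hrp hsp ha hu hv' heq hcopr
    have h2 : ((r * s * a * u * v' : ℕ) : ℝ) ≤ (R : ℝ) ^ 14 := by exact_mod_cast hbd
    have h3 : ((r * s * a * u * v' : ℕ) : ℝ) ^ N ≤ ((R : ℝ) ^ 14) ^ N :=
      pow_le_pow_left₀ (by positivity) h2 N
    calc (c : ℝ) = ((s ^ w * v' : ℕ) : ℝ) := by rw [hc]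
      _ ≤ CP * ((r * s * a * u * v' : ℕ) : ℝ) ^ N := h1
      _ ≤ CP * ((R : ℝ) ^ 14) ^ N := mul_le_mul_of_nonneg_left h3 hCP.le
      _ = CP * (R : ℝ) ^ (14 * N) := by rw [← pow_mul]
      _ ≤ CP * (R : ℝ) ^ (14 * N + 8) := mul_le_mul_of_nonneg_left hpow14 hCP.le
      _ < (CP + 3) * (R : ℝ) ^ (14 * N + 8) := by nlinarith

end Summit.ABC.ABC.Theorems.DepthCountedABC
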